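import Mathlib
import HarnessLib
import Summits.Langlands.Langlands.Theses.SkinnerWilesDefectOne

/-!
# Complete local rings with finite residue rings are compact (adic topology)

Route `SkinnerWilesDefectOne`, support item stmt-Langlands-14718
(`ProModularOfEisensteinSeed : EisensteinProModularSeed → ReducibleOrdinaryProModular`).  To turn the
seed's `p`-adically automorphic POINT `x : 𝕋(𝒰) → ℚ̄_p` into a pro-modular PRIME of the nearly
ordinary deformation ring `R_𝒟` ([SW, §4.1]: "`𝔮` is pro-modular if there is a map
`T_𝒟 → R_𝒟/𝔮` …") one must factor `x` through the image `φ(R_𝒟) ≅ R_𝒟/ker φ` of the classifying map,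
which requires `φ(R_𝒟)` to be CLOSED in `ℚ̄_p` — i.e. `R_𝒟` compact.  This file proves the general
fact behind it ("coefficient rings are profinite", [Mazur, §2]):

* `compactSpace_of_isAdicComplete` — a ring `R` that is `I`-adically complete with all `R/Iⁿ` finite
  is COMPACT in the `I`-adic topology: `R → ∏ₙ R/Iⁿ` is a topological embedding (the adic
  neighbourhood basis `Iⁿ` is the pull-back of the product of discrete topologies) with closed image
  (the compatible sequences, by `IsPrecomplete`), and the product of finite discrete spaces is compact;
* `compactSpace_adic_of_isNoetherianRing` — in particular a complete noetherian local ring with finite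
  residue field (e.g. `R_𝒟` over `𝒪 = 𝒪_E`, `k` finite) is compact in its `𝔪`-adic topology
  (`IsLocalRing.finite_quotient_iff`).

References: B. Mazur, *An introduction to the deformation theory of Galois representations* (1997),
§2 ("`A = proj lim A/𝔪_A^ν` … profinite"); C. M. Skinner, A. J. Wiles, Publ. Math. IHÉS 89 (1999),
§4.1. [Mazur1997Deformation] [SkinnerWiles1999]
-/

set_option linter.dupNamespace false -- project-wide option (lakefile weak.linter.dupNamespace); `Summit.Langlands.Langlands` is the mandated namespace

namespace Summit.Langlands.Langlands.Theorems

open Filter Topology IsLocalRing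

/-- **An adically complete ring with finite quotients `R/Iⁿ` is compact in the `I`-adic topology.**
[cite: Mazur1997Deformation, §2] -/
theorem compactSpace_of_isAdicComplete {R : Type*} [CommRing R] (I : Ideal R) [IsAdicComplete I R]
    (hfin : ∀ n : ℕ, Finite (R ⧸ I ^ n)) : @CompactSpace R I.adicTopology := by
  letI : WithIdeal R := ⟨I⟩
  -- the product of the discrete finite quotients
  letI tQ : ∀ n : ℕ, TopologicalSpace (R ⧸ I ^ n) := fun _ => ⊥
  haveI : ∀ n : ℕ, DiscreteTopology (R ⧸ I ^ n) := fun _ => ⟨rfl⟩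
  haveI : ∀ n : ℕ, Finite (R ⧸ I ^ n) := hfin
  let ι : R →+* (∀ n : ℕ, R ⧸ I ^ n) := RingHom.pi fun n => Ideal.Quotient.mk (I ^ n)
  have hιn : ∀ (r : R) (n : ℕ), ι r n = Ideal.Quotient.mk (I ^ n) r := fun _ _ => rfl
  -- `ι` is a topological embedding: the adic basis `Iⁿ` is the pull-back of the product basis
  have hind : IsInducing ι := by
    rw [IsTopologicalAddGroup.isInducing_iff_nhds_zero,
      (I.hasBasis_nhds_zero_adic).eq_iInf, nhds_pi, Filter.pi, Filter.comap_iInf]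
    refine iInf_congr fun n => ?_
    rw [Filter.comap_comap, nhds_discrete, Filter.comap_pure]
    congr 1
    ext r
    simp only [Set.mem_preimage, Function.comp_apply, Function.eval, Set.mem_singleton_iff,
      SetLike.mem_coe, hιn, Pi.zero_apply, Ideal.Quotient.eq_zero_iff_mem]
  -- the image is the closed set of compatible sequences
  have hrange : Set.range ι = {y | ∀ m n : ℕ, ∀ h : m ≤ n,
      Ideal.Quotient.factor (Ideal.pow_le_pow_right h) (y n) = y m} := by
    ext y
    constructor
    · rintro ⟨r, rfl⟩ m n h
      rw [hιn, hιn, Ideal.Quotient.factor_mk]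
    · intro hy
      -- lift the compatible sequence and take the adic limit
      obtain ⟨L, hL⟩ := IsPrecomplete.prec' (I := I) (fun n => (y n).out) (fun {m n} h => by
        rw [SModEq.sub_mem, smul_eq_mul, Ideal.mul_top, ← Ideal.Quotient.eq,
          Ideal.Quotient.mk_out]
        have := hy m n h
        rw [← Ideal.Quotient.mk_out (y n), Ideal.Quotient.factor_mk] at this
        exact this.symm)
      refine ⟨L, funext fun n => ?_⟩
      have hn := hL n
      rw [SModEq.sub_mem, smul_eq_mul, Ideal.mul_top, ← Ideal.Quotient.eq, Ideal.Quotient.mk_out] at hn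
      rw [hιn, ← hn]
  have hclosed : IsClosed (Set.range ι) := by
    rw [hrange]
    have e : {y : ∀ n : ℕ, R ⧸ I ^ n | ∀ m n : ℕ, ∀ h : m ≤ n,
        Ideal.Quotient.factor (Ideal.pow_le_pow_right h) (y n) = y m} =
        ⋂ m : ℕ, ⋂ n : ℕ, ⋂ h : m ≤ n,
          {y | Ideal.Quotient.factor (Ideal.pow_le_pow_right h) (y n) = y m} := by
      ext y; simp only [Set.mem_setOf_eq, Set.mem_iInter]
    rw [e]
    refine isClosed_iInter fun m => isClosed_iInter fun n => isClosed_iInter fun h => ?_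
    exact isClosed_eq ((continuous_of_discreteTopology).comp (continuous_apply n)) (continuous_apply m)
  -- conclude
  refine ⟨?_⟩
  rw [hind.isCompact_iff, Set.image_univ]
  exact hclosed.isCompact

/-- **A complete noetherian local ring with finite residue field is compact** in its `𝔪`-adic
topology ("coefficient rings are profinite"; e.g. `R_𝒟` over `𝒪_E` with finite `k`).
[cite: Mazur1997Deformation, §2] -/
theorem compactSpace_adic_of_isNoetherianRing (R : Type*) [CommRing R] [IsNoetherianRing R]
    [IsLocalRing R] [IsAdicComplete (maximalIdeal R) R] [Finite (ResidueField R)] :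
    @CompactSpace R (maximalIdeal R).adicTopology :=
  compactSpace_of_isAdicComplete (maximalIdeal R) fun n =>
    IsLocalRing.finite_quotient_iff.mpr ⟨n, le_rfl⟩

end Summit.Langlands.Langlands.Theorems
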